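import Summits.HubbardSuperconductivity.HubbardSuperconductivity.Theses.DeformationLadder
import Summits.HubbardSuperconductivity.HubbardSuperconductivity.Theorems.DeformationLadderDeformedRungGap
import Literature.MathematicalPhysics.QuantumLattice.HubbardGrandCanonicalDensity

/-!
# `DeformedRung` (stmt-HubbardSuperconductivity-1894, route `DeformationLadder`) — the rung

**Theorem (`deformedRung_proof`).** For every `g > 0` and `δ ∈ (0,1/2)` there is `U₀ > 0` such that
for all `U ∈ [0,U₀)`, eventually in the side `L` (odd `L` included), EVERY normalised
`(2⌊(1−δ)L²/2⌋, S^z = 0)`-sector ground state `φ` of the number-conserving deformation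
`K_L(U,g) = hubbardTorus 2 L 1 U − (g/L²) pFᴴpF` (`pF = pairField dWaveFormFactor L`) has d-wave
long-range order `a ≤ L⁻⁴ re⟨φ, pFᴴpF φ⟩` with `a = (κ − U)/g > 0`, `U₀ = κ(g,δ)`.

Proof (no expansion in `U`, no ensemble equivalence, no approximating-Hamiltonian lower bound):
* the left chord of the concave sector energy `E_L(U,·)` (`leftChord_le_order`,
  Theorems/TwTipContinuation/Negative/SeededChords): `E_L(U,0) − E_L(U,g) ≤ (g/L²) re⟨φ, pFᴴpF φ⟩`
  for every sector ground state `φ` at `g`;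
* the repulsion sandwich on the sector (`sectorEnergy_mono_coupling`,
  `sectorEnergy_le_add_coupling`): `K_L(U,g) = K_L(0,g) + U Σ_x n_{x↑}n_{x↓}` with
  `0 ≤ Σ_x n_{x↑}n_{x↓} ≤ L²`, so `E_L(0,0) ≤ E_L(U,0)` and `E_L(U,g) ≤ E_L(0,g) + U L²`;
* the extensive gap of the `U = 0` reduced d-wave BCS torus at every doping and every side
  (`extensiveGap_all`, Theorems/DeformationLadderDeformedRungGap: BCS trial state, d-wave Cooper
  logarithm, sector transfer): `κ L² ≤ E_L(0,0) − E_L(0,g)` eventually in `L`.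
Hence `(κ − U) L² ≤ (g/L²) re⟨φ, pFᴴpF φ⟩`. Sources: Bardeen–Cooper–Schrieffer (1957); Bogoliubov
(1958); Kaplan–Horsch–von der Linden (1989) (the chord); Bach–Lieb–Solovej (1994) (positivity of the
on-site repulsion); folklore otherwise.
-/

noncomputable section

namespace Summit.HubbardSuperconductivity.DeformationLadder.DeformedRung

open Matrix Filter Finset
open Literature.MathematicalPhysics.QuantumLattice Literature.Probability.LatticeModels
open Summit.HubbardSuperconductivity.TwTipContinuation.Negative
open Summit.HubbardSuperconductivity.TwTipContinuation.IsogapTransport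
open scoped ComplexOrder

section Sandwich

variable (L : ℕ)

/-- `0 ≤ re⟨ψ, Σ_x n_{x↑}n_{x↓} ψ⟩`. [folklore] -/
theorem re_expect_interaction_nonneg (ψ : Fock (Orb (FermionTorus 2 L))) :
    0 ≤ (expect (∑ x : FermionTorus 2 L, numberOp x 0 * numberOp x 1) ψ).re :=
  (Complex.nonneg_iff.1
    ((posSemidef_sum_numberOp_mul_numberOp (Λ := FermionTorus 2 L)).dotProduct_mulVec_nonneg ψ)).1

/-- `re ⟨ψ, diag(d) ψ⟩ = Σ_s d(s) ‖ψ s‖²` for a natural-number diagonal (the `DecidableEq`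
instance is an ordinary implicit argument, so that the lemma rewrites diagonals built from any
instance). [folklore] -/
theorem re_star_dotProduct_diagonal_natCast_mulVec {ι : Type*} [Fintype ι] {inst : DecidableEq ι}
    (d : ι → ℕ) (ψ : ι → ℂ) :
    (star ψ ⬝ᵥ (@Matrix.diagonal ι ℂ inst _ (fun s => ((d s : ℕ) : ℂ)) *ᵥ ψ)).re = ∑ s, (d s : ℝ) * ‖ψ s‖ ^ 2 := by
  simp only [mulVec_diagonal, dotProduct, Pi.star_apply, Complex.star_def, Complex.re_sum]
  refine Finset.sum_congr rfl fun s _ => ?_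
  have : (starRingEnd ℂ) (ψ s) * (((d s : ℕ) : ℂ) * ψ s) = (((d s : ℝ) * ‖ψ s‖ ^ 2 : ℝ) : ℂ) := by
    rw [mul_left_comm, Complex.conj_mul', Complex.ofReal_mul, Complex.ofReal_pow, Complex.ofReal_natCast]
  rw [this, Complex.ofReal_re]

/-- `re⟨ψ, Σ_x n_{x↑}n_{x↓} ψ⟩ ≤ L²` on unit vectors (at most one doubly occupied pair per site:
`Σ_x n_{x↑}n_{x↓}` is the diagonal of doubly-occupied-site counts). [folklore] -/
theorem re_expect_interaction_le {ψ : Fock (Orb (FermionTorus 2 L))} (hψ : star ψ ⬝ᵥ ψ = 1) :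
    (expect (∑ x : FermionTorus 2 L, numberOp x 0 * numberOp x 1) ψ).re ≤ (L : ℝ) ^ 2 := by
  have hnorm : ∑ s, ‖ψ s‖ ^ 2 = 1 := by
    have h := congrArg Complex.re hψ
    simp only [dotProduct, Pi.star_apply, Complex.star_def, Complex.re_sum, Complex.one_re] at h
    rw [← h]
    refine Finset.sum_congr rfl fun s _ => ?_
    rw [Complex.conj_mul', ← Complex.ofReal_pow, Complex.ofReal_re]
  rw [Literature.MathematicalPhysics.QuantumLattice.expect, sum_numberOp_mul_numberOp_eq_diagonal,
    re_star_dotProduct_diagonal_natCast_mulVec]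
  calc ∑ s, ((doublyOccupied s).card : ℝ) * ‖ψ s‖ ^ 2 ≤ ∑ s, (L : ℝ) ^ 2 * ‖ψ s‖ ^ 2 := by
        refine Finset.sum_le_sum fun s _ => mul_le_mul_of_nonneg_right ?_ (sq_nonneg _)
        have h := Finset.card_le_univ (doublyOccupied s)
        rw [Summit.HubbardSuperconductivity.NoGo.card_fermionTorus_two] at h
        exact_mod_cast h
    _ = (L : ℝ) ^ 2 := by rw [← Finset.mul_sum, hnorm, mul_one]

variable [NeZero L]

/-- **The deformation family differs across couplings by the repulsion alone**:
`K_L(U,g) = K_L(0,g) + U Σ_x n_{x↑} n_{x↓}`. [folklore] -/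
theorem seededH_eq_add_interaction (U g : ℝ) :
    (hubbardTorus 2 L 1 U - ((g / (L : ℝ) ^ 2 : ℝ) : ℂ) • ((pairField dWaveFormFactor L)ᴴ * pairField dWaveFormFactor L)) =
      (hubbardTorus 2 L 1 0 - ((g / (L : ℝ) ^ 2 : ℝ) : ℂ) • ((pairField dWaveFormFactor L)ᴴ * pairField dWaveFormFactor L)) +
        (U : ℂ) • ∑ x : FermionTorus 2 L, numberOp x 0 * numberOp x 1 := by
  have h : hubbardTorus 2 L 1 U - hubbardTorus 2 L 1 0 =
      ((U - 0 : ℝ) : ℂ) • ∑ x : FermionTorus 2 L, numberOp x 0 * numberOp x 1 := by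
    have := hamiltonianWith_sub_hamiltonianWith (fermionTorusGraph 2 L) 1 0 U 0
    rwa [hamiltonianWith_zero, hamiltonianWith_zero] at this
  rw [sub_zero, sub_eq_iff_eq_add] at h
  rw [h]
  abel

/-- `re⟨ψ, K_L(U,g) ψ⟩ = re⟨ψ, K_L(0,g) ψ⟩ + U · re⟨ψ, Σ_x n_{x↑}n_{x↓} ψ⟩`. [folklore] -/
theorem re_expect_seededH_coupling (U g : ℝ) (ψ : Fock (Orb (FermionTorus 2 L))) :
    (expect (hubbardTorus 2 L 1 U - ((g / (L : ℝ) ^ 2 : ℝ) : ℂ) • ((pairField dWaveFormFactor L)ᴴ * pairField dWaveFormFactor L)) ψ).re =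
      (expect (hubbardTorus 2 L 1 0 - ((g / (L : ℝ) ^ 2 : ℝ) : ℂ) • ((pairField dWaveFormFactor L)ᴴ * pairField dWaveFormFactor L)) ψ).re +
        U * (expect (∑ x : FermionTorus 2 L, numberOp x 0 * numberOp x 1) ψ).re := by
  rw [seededH_eq_add_interaction L U g, expect_add, expect_smul, Complex.add_re, Complex.re_ofReal_mul]

/-- **The sector energy is non-decreasing in the repulsion**: `E_L(0,g) ≤ E_L(U,g)` for `0 ≤ U`
in every sector `(2n, S^z = 0)`, `n ≤ L²` (`Σ_x n_{x↑}n_{x↓} ≥ 0`, variational principle).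
Bach–Lieb–Solovej (1994); Tasaki (2020) §2.1. [folklore] -/
theorem sectorEnergy_mono_coupling (g : ℝ) {U : ℝ} (hU : 0 ≤ U) {n : ℕ} (hn : n ≤ Fintype.card (FermionTorus 2 L)) :
    Matrix.minEnergyOn (hubbardTorus 2 L 1 0 - ((g / (L : ℝ) ^ 2 : ℝ) : ℂ) • ((pairField dWaveFormFactor L)ᴴ * pairField dWaveFormFactor L)) (szSector (2 * n) 0) ≤
      Matrix.minEnergyOn (hubbardTorus 2 L 1 U - ((g / (L : ℝ) ^ 2 : ℝ) : ℂ) • ((pairField dWaveFormFactor L)ᴴ * pairField dWaveFormFactor L)) (szSector (2 * n) 0) := by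
  obtain ⟨ψ, hψ1, hgs⟩ := exists_unit_groundState U g L hn
  have hE := expect_eq_of_groundState L hψ1 hgs
  obtain ⟨-, hb⟩ := seeded_sector_groundState 0 g L hn
  have hvar := hb ψ hgs.1 hψ1
  have hsplit := re_expect_seededH_coupling L U g ψ
  have hW := re_expect_interaction_nonneg L ψ
  have hUW : 0 ≤ U * (expect (∑ x : FermionTorus 2 L, numberOp x 0 * numberOp x 1) ψ).re := mul_nonneg hU hW
  rw [hE, Complex.ofReal_re] at hsplit
  linarith

/-- **… and moves by at most `U L²`**: `E_L(U,g) ≤ E_L(0,g) + U L²` for `0 ≤ U` in every sector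
`(2n, S^z = 0)`, `n ≤ L²` (`Σ_x n_{x↑}n_{x↓} ≤ L²`, variational principle).
Bach–Lieb–Solovej (1994); Tasaki (2020) §2.1. [folklore] -/
theorem sectorEnergy_le_add_coupling (g : ℝ) {U : ℝ} (hU : 0 ≤ U) {n : ℕ} (hn : n ≤ Fintype.card (FermionTorus 2 L)) :
    Matrix.minEnergyOn (hubbardTorus 2 L 1 U - ((g / (L : ℝ) ^ 2 : ℝ) : ℂ) • ((pairField dWaveFormFactor L)ᴴ * pairField dWaveFormFactor L)) (szSector (2 * n) 0) ≤
      Matrix.minEnergyOn (hubbardTorus 2 L 1 0 - ((g / (L : ℝ) ^ 2 : ℝ) : ℂ) • ((pairField dWaveFormFactor L)ᴴ * pairField dWaveFormFactor L)) (szSector (2 * n) 0) +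
        U * (L : ℝ) ^ 2 := by
  obtain ⟨ψ, hψ1, hgs⟩ := exists_unit_groundState 0 g L hn
  have hE := expect_eq_of_groundState L hψ1 hgs
  obtain ⟨-, hb⟩ := seeded_sector_groundState U g L hn
  have hvar := hb ψ hgs.1 hψ1
  have hsplit := re_expect_seededH_coupling L U g ψ
  have hW := re_expect_interaction_le L hψ1
  have hUW : U * (expect (∑ x : FermionTorus 2 L, numberOp x 0 * numberOp x 1) ψ).re ≤ U * (L : ℝ) ^ 2 :=
    mul_le_mul_of_nonneg_left hW hU
  rw [hE, Complex.ofReal_re] at hsplit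
  linarith

end Sandwich

/-- **The deformed rung at one side.** If `κ L² ≤ E_L(0,0) − E_L(0,g)` (`g > 0`) and
`0 ≤ U`, then every normalised sector ground state `φ` of `K_L(U,g)` has
`(κ − U)/g ≤ L⁻⁴ re⟨φ, pFᴴpF φ⟩` (chord + repulsion sandwich). [folklore] -/
theorem order_of_gap_coupling {g κ U : ℝ} (hg : 0 < g) (hU : 0 ≤ U) {L : ℕ} [NeZero L] {n : ℕ}
    (hgap : κ * (L : ℝ) ^ 2 ≤
      (Matrix.minEnergyOn (hubbardTorus 2 L 1 0) (szSector (2 * n) 0))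
        - (Matrix.minEnergyOn (hubbardTorus 2 L 1 0 - ((g / (L : ℝ) ^ 2 : ℝ) : ℂ) • ((pairField dWaveFormFactor L)ᴴ * pairField dWaveFormFactor L)) (szSector (2 * n) 0)))
    {φ : Fock (Orb (FermionTorus 2 L))} (hφ : star φ ⬝ᵥ φ = 1)
    (hgs : IsGroundStateInSector (hubbardTorus 2 L 1 U - ((g / (L : ℝ) ^ 2 : ℝ) : ℂ) • ((pairField dWaveFormFactor L)ᴴ * pairField dWaveFormFactor L)) (2 * n) 0 φ) :
    (κ - U) / g ≤ (expect ((pairField dWaveFormFactor L)ᴴ * pairField dWaveFormFactor L) φ).re / (L : ℝ) ^ 4 := by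
  have hn : n ≤ Fintype.card (FermionTorus 2 L) := le_card_of_mem_szSector L hgs.1 hgs.2.1
  have hchord := leftChord_le_order (U := U) (g := g) (g' := 0) (L := L) (n := n) hg hφ hgs
  have hmono := sectorEnergy_mono_coupling L 0 hU hn
  rw [seededH_zero, seededH_zero] at hmono
  have hle := sectorEnergy_le_add_coupling L g hU hn
  have hL0 := NeZero.pos L
  have hL : (0 : ℝ) < (L : ℝ) ^ 2 := by positivity
  have hL4 : (0 : ℝ) < (L : ℝ) ^ 4 := by positivity
  have key : (κ - U) * (L : ℝ) ^ 2 ≤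
      (g - 0) / (L : ℝ) ^ 2 * (expect ((pairField dWaveFormFactor L)ᴴ * pairField dWaveFormFactor L) φ).re := by
    rw [seededH_zero] at hchord
    linarith
  rw [sub_zero, div_mul_eq_mul_div, le_div_iff₀ hL] at key
  rw [div_le_div_iff₀ hg hL4]
  calc (κ - U) * (L : ℝ) ^ 4 = (κ - U) * (L : ℝ) ^ 2 * (L : ℝ) ^ 2 := by ring
    _ ≤ g * (expect ((pairField dWaveFormFactor L)ᴴ * pairField dWaveFormFactor L) φ).re := key
    _ = (expect ((pairField dWaveFormFactor L)ᴴ * pairField dWaveFormFactor L) φ).re * g := mul_comm _ _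

end Summit.HubbardSuperconductivity.DeformationLadder.DeformedRung

namespace Summit.HubbardSuperconductivity.HubbardSuperconductivity.Theorems

open Literature.MathematicalPhysics.QuantumLattice
open Summit.HubbardSuperconductivity.DeformationLadder.DeformedRung

-- the sub-problem namespace `Summit.HubbardSuperconductivity.HubbardSuperconductivity.Theorems` is the
-- harness convention for closing theorems (summit = problem name), hence the duplicated component
set_option linter.dupNamespace false in
/-- **`DeformedRung` (item stmt-HubbardSuperconductivity-1894 of route `DeformationLadder`).** For
every `g > 0` and `δ ∈ (0,1/2)` there is `U₀ > 0` (the extensive-gap constant `κ(g,δ)` of the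
`U = 0` reduced d-wave BCS torus) such that for all `U ∈ [0,U₀)`, with `a = (κ − U)/g > 0`,
eventually in `L` (every parity), EVERY normalised `(2⌊(1−δ)L²/2⌋, S^z = 0)`-sector ground state
`φ` of `hubbardTorus 2 L 1 U − (g/L²) pFᴴpF` has `a ≤ L⁻⁴ re⟨φ, pFᴴpF φ⟩`: every-ground-state
d-wave long-range order of the weakly repulsive, fully hopping 2D Hubbard torus with a reduced
d-wave BCS attraction. Chord of the concave sector energy + repulsion sandwich + extensive BCS gap
(`order_of_gap_coupling`, `extensiveGap_all`). [folklore] -/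
theorem deformedRung_proof :
    Summit.HubbardSuperconductivity.HubbardSuperconductivity.Theses.DeformationLadder.DeformedRung := by
  intro g hg δ hδ
  obtain ⟨κ, hκ, L₀, hgap⟩ := extensiveGap_all δ hδ g hg
  refine ⟨κ, hκ, fun U hU => ⟨(κ - U) / g, div_pos (sub_pos.2 hU.2) hg, L₀, fun L _ hL φ hφ hgs => ?_⟩⟩
  exact order_of_gap_coupling hg hU.1 (hgap L hL) hφ hgs

end Summit.HubbardSuperconductivity.HubbardSuperconductivity.Theorems
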